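import Literature.MathematicalPhysics.QuantumFieldTheory.Balaban1983to89.B9LeafXCodedKnitUParH

/-!
# `Balaban1983to89.B9LeafXCodedKnitUParHX` — CASCADE-K «K2-G-X»: THE [B9] CARRIER BUNDLE OVER THE CODED CARRIER WITH THE CODED CLASS (3.37) A PARAMETER
# (`carriersYUParHX … C37 …`, `Y9OfRecordUParHX`, `Y9OfRecordUPbParHX`) AND LEAF EDITION 3 `b9LeafX_carriersYUParHX` — the class-generic re-press ONCE of
# node00-def-Y's `Node00.carriersYUParH` (edition 2, class hard-wired to `C37GY … (cqY d)` through `codingYU`) and of dag-n06-d's leaf `b9LeafX_carriersYUParH`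

T. Bałaban, *Propagators for lattice gauge theories in a background field*, Commun. Math. Phys. **99** (1985) 389–434 [`Balaban1985BackgroundPropagators`, "B9"],
Sect. 3: Thms 3.1–3.4 and Cors 3.5–3.6 pp. 397–408, Thms 3.7–3.15 pp. 409–432, the class (3.35)–(3.38) p. 396, the site transporter (3.19) p. 393, the contours
(3.21) p. 394 (averaging) and (3.40) p. 397 (Hölder norms), (3.55)–(3.58) pp. 401–402 (the averaging transporter's variation on the class (3.35) × (3.37));
T. Bałaban, *Averaging operations for lattice gauge theories*, Commun. Math. Phys. **98** (1985) 17–51 [`Balaban1985Averaging`], Prop. 2 p. 26 (print's knit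
transporter); [4] = `Balaban1984PropagatorsII`, Props. 2.2, 2.3, 2.6 (the case `U = 1`).

statement-level skeleton of published theorems with citation tags; proofs where landed; nothing here is a claim about the Yang–Mills mass gap

CITATION HEADER (lean-in-tree rule).  Cell `pub-ymgap` (HUMAN RULING D-0062, YM Track A), node N06 [B9], seat `pub-ymgap-dag-n06-c` (gen 27; K2-G lane; K1⁹
`stmt-QuantumFields-27364` SUPPORTS lane), 2026-08-30/31.  WHY THIS FILE.  The knit certificate «KA» ∕ «KC» ∕ «KE₁» (dag-n06-d, `Summits/…/BalabanUVNodesN06AtOpsYSectESt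
KnitPairKA ∕ KC ∕ …KnitRecordKE`) displays the coded Sect.-B step `hBK : Thm 3.2 → Thm 3.3 → SectBStepUPar … parKnitY parSymY … (fun j => C37GY SU(N) (f j) (ιB j) (cqY d₆)) …`
at the EXTENDED STRAIGHT class `C37GY` — because the bundle it leafs onto, node00-def-Y's `carriersYUParH` ∕ `Y9OfRecordUPbParH`, codes the record's backgrounds
by `codingYU := codingYx … (C37GY … (cqY d)) …` (`Node00.CarriersYU` :99).  At print's KNIT averaging transporter `parKnitY` ([B8] Prop. 2) the Sect.-B junction needs
(3.58) for `parKnitY` (`CplxLettersY … (parKnitY _) …`), and the tree's (3.58) road for the knit transporter (`B9Eq358KnitTransporterVariationY.parVar337Y_parKnitY`,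
dag-n06-l) — like print p. 401 — READS THE (3.35) DATUM OF THE BASE, which `C37GY` does not carry; the landed knit Sect.-B step of record
(`Summit.….N06SectBStepUParKnitRecord.sectBStepUPar_knitRecord`) therefore concludes at the KNIT class `B9SectBCodedClassKnitY.C37KY …` ((3.35) × (3.37), node00-def-Y
ruling I.20728 (ii): «the (3.37)∕C37 coding is a Sect.-B proof device … the θ-record carries letters and pins, never analytic-class codings»).  Re-keying `codingYU` in place
would re-type its ≈ 120 landed consumers; THIS ADDITIVE FILE makes the coded class a PARAMETER instead, so that the certificate's edition 2 is a token swap: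

* §1 ★★★ `carriersYUParHX P G f b C37 C38 parA parH OA ops` — `Node00.carriersYUParH` VERBATIM with `C37 : ∀ j, ℝ → CfgY 𝔸 (f j).toKIdx → AfldY 𝔸 (f j).toKIdx → Prop`
  a parameter (`codingYU P G f ιB C38 j ↦ codingYx P G (f j) (C37 j) (C38 j)`; the block labelling `ιB` drops out); ★ `carriersYUParH_eq_carriersYUParHX` (`rfl`: edition 2 IS
  the instance at `C37 := fun j => C37GY G (f j) (ιB j) (cqY d)`); the faces of `Node00.CarriersYUParH` §2–§2c re-read (`rfl` ∕ `Iff.rfl`; (3.37) now READS `C37 j`).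
* §2 at the record (`M_N(ℂ)`, `SU(N)`): `Y9OfRecordUParHX N θ Mstar P ops f b C37 C38 parA parH OA`, and at the record's reading of print's class `P := extraYPb`,
  `Y9OfRecordUPbParHX N θ Mstar ops f b C37 C38 parA parH OA`; ★ `Y9OfRecordUParH_eq_Y9OfRecordUParHX`, `Y9OfRecordUPbParH_eq_Y9OfRecordUPbParHX` (`rfl`) and faces.
* §3 ★★★ `b9LeafX_carriersYUParHX` — dag-n06-d's `b9LeafX_carriersYUParH` VERBATIM (the same forty hypotheses: `hone`, the `U = 1` comparisons, the null readings, the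
  residual entries, the three letter pins, rows 15–26 at `(regC335 P, regC336 P)`, the [B6] block) except that the coded Sect.-B step `hB : Thm32Printed → Thm33Printed →
  SectBStepUPar P f (d+1) c35Y G b parA parH OA (fun j => parBY _) C37 C38 (CinvY P f G parA)` is read AT THE PARAMETER CLASS and the conclusion is
  `B9LeafX (carriersYUParHX P G f b C37 C38 parA parH OA ops)`; proof verbatim (`codingYU … j ↦ codingYx … (C37 j) (C38 j)`) through edition 2's §1
  (`thm31Printed_codedUPar ∕ baseU1Printed_codedUPar ∕ thm33Printed_codedUPar`, already class-parametric) and edition 1's `thm32Printed_codedU`.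

CONSUMER RECIPE («KA ed.2», dag-n06-d; then KE₂ folds `hBK := fun h32 h33 => sectBStepUPar_knitRecord …`).  With
`𝒞 := fun j => C37KY SU(N) (f j) (ιB j) (fun α₀ U => (bg9YC 𝕄 SU(N) (extraYPb 𝕄 SU(N)) (f j)).Reg335 c35Y α₀ U) (cqY θ.d₆) CqK MK aInv (ϱ′·L³∕3)` (the token of
`sectBStepUPar_knitRecord`, new real binders `CqK MK aInv ϱ′`): conclusion `B9LeafX (Y9OfRecordUPbParHX N θ M⋆ INST f bR 𝒞 C38 (fun j => parKnitY _) (fun j => parSymY _) (fun j => GAQY …))`,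
`hBK`'s last arrow `… → SectBStepUPar … 𝒞 C38 (CinvY …)`, `exact b9LeafX_carriersYUParHX … (C37 := 𝒞) …` — nothing else changes.

RELATED IN THE TREE, NOT DUPLICATED (USED BY NAME): `Node00.CarriersYUParH` (edition 2; its instance lemma is §1's `rfl`), `B9LeafXCodedKnitUParH` (leaf edition 2 and
its class-parametric §1), `B9LeafXCodedKnitU` (§0 reindex lemmas), `B9SectBGpFrameCodedYR.codingYx`, `B9SectBCodedReadingsUParH` (`KSCUPar`, `SectBStepUPar`),
`B9SectBStepUOfMembersR.thm32Printed_codedU`, `B9SectBCodedCarrierPullbacks` (`…_coded`), `B9LeafKnitOn.baseU1_of_b6BlockParam_on`, `B9` (the abstract Sect.-B algebra).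
HONEST STATUS.  Definitions by field assignment, `rfl` ∕ `Iff.rfl` faces, ONE verbatim re-keyed leaf; nothing about Theorems 3.1–3.15 is proved here (every printed
statement is a displayed hypothesis of the leaf, as in edition 2); a HELPER by key 27364; COUNT-NEUTRAL; NOT the discharge of N06; K1⁹ NOT closed; one finite 𝕋⁴
programme at fixed `ε` — nothing continuum ∕ ℝ⁴ ∕ OS ∕ mass gap ∕ Clay; the Yang–Mills mass gap is NOT proved here.  NEW file; nothing landed is modified.
No `sorry`, no `axiom`, no `instance`, no `notation`.  Net new unproved facts: 0.
-/

noncomputable section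

namespace Literature.MathematicalPhysics.QuantumFieldTheory.Balaban1983to89.B9LeafXCodedKnitUParHX

open DagBinding (PrintedCarriers9X B9LeafX B6BlockParam)
open B9PinMembersKLevelV1 (MemberY geo9Y bg9Y)
open B9BackgroundsKLevelV1P (bg9KP)
open B9BackgroundsKLevelV1R (RegFamY bg9YR kernelFamilyR kernelFamilyRY siteKernelR fineKernelR rwExpansionR rwKernelExpansionR hKernelR hKernelRY)
open B9PinGeometryKLevelV1 (dOmegaY OmKY inΛY unitDistY InCubeY c35Y c35Y_pos dictAtOneY not_inCubeY)
open B9PinCarriersKLevelV1 (OperatorLayerY)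
open B9PinCarriersKLevelV1R (carriersYR)
open B9SectBCodedClassR (RegExtraY regC335 regC336 bg9YC extraY extraYPb)
open B9SectBGpLettersY (GVal)
open B9SectBCodedCarrier (CCfg Coding pullK pullS thm33Printed_coded)
open B9SectBCodedCarrierPullbacks (pullF pullH pullRW pullRWK pullC pullPK pullPH pullPK₀ thm31Printed_coded thm37Printed_coded cor38Printed_coded thm39Printed_coded
  thm310Printed_coded thm311Printed_coded thm312Printed_coded thm313Printed_coded thm314Printed_coded thm314LocalPrinted_coded thm315FullPrinted_coded
  stmt349Printed_coded stmt3132Printed_coded)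
open B9SectBGpFrameCodedYR (codingYx)
open B9SectBCodedReadingsUR (KSCU KACU SectBStepU)
open B9SectBCodedReadingsUParH (KSCUPar SectBStepUPar)
open B9SectBCodedChainAnR (IsAnKY)
open B9SectBKerFrameCodedYR (CinvY)
open B9SectBCodedClassGY (C37GY)
open B9SectBStepsKSCUR (KSCU_members_base KACU_members_base ineq342_346_347_congr thms_KSCU_base_iff)
open B9SectBGpTransferInYR (ineq343_345_congr)
open B9SectBStepUOfMembersR (thm32Printed_codedU thm33Printed_codedU)
open B9LeafKnitOn (baseU1_of_b6BlockParam_on)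
open B9Eq360DeltaPrimeAY (AfldY)
open B6Ineq2142KLevelV1 (β)
open B7Prop2SpecialUnitary (specialUnitaryUnits)
open Node00 (SiteY BlkY IBondY CfgY SiteParY BondParY BondOpY GAY GpY CY parSymY parBY kernelFamilyS kernelFamilyB siteKernelOfOp carriersYU carriersYUPar
  carriersYUParH codingYU cqY OpsY Stage3Params Y9OfRecordP Y9OfRecordUParH Y9OfRecordUPbParH)
open B9LeafXCodedKnitU (thm37Printed_reindex cor38Printed_reindex thm39Printed_reindex thm310Printed_reindex thm311Printed_reindex thm312Printed_reindex
  thm313Printed_reindex thm314Printed_reindex thm314LocalPrinted_reindex thm315FullPrinted_reindex stmt349Printed_reindex stmt3132Printed_reindex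
  baseU1Printed_reindex thm31Printed_reindex thm32Printed_reindex thm33Printed_reindex)
open B9LeafXCodedKnitUParH (thm31Printed_codedUPar baseU1Printed_codedUPar thm33Printed_codedUPar)
open scoped Matrix.Norms.L2Operator

variable {d ℓ : ℕ} {hd : 1 ≤ d + 1} {hL : Odd (ℓ + 1) ∧ 1 < ℓ + 1} {b₀ b₁ : ℝ} {Mstar : ℕ}

/-! ## §1. The bundle over the coded carrier with the coded class (3.37) a parameter -/

section Bundle

variable {𝔸 : Type} [NormedRing 𝔸] [NormedAlgebra ℂ 𝔸] [CompleteSpace 𝔸] (P : RegExtraY d ℓ hd hL b₀ b₁ Mstar 𝔸) (G : Subgroup 𝔸ˣ)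
  {J : Type} (f : J → MemberY d ℓ hd hL b₀ b₁ Mstar) {ι : Type} [Fintype ι] (b : Module.Basis ι ℝ 𝔸)
  (ιB : ∀ j : J, BlkY (f j).toKIdx → IBondY (f j).toKIdx) (C37 C38 : ∀ j : J, ℝ → CfgY 𝔸 (f j).toKIdx → AfldY 𝔸 (f j).toKIdx → Prop)
  (parA parH : ∀ j : J, SiteParY 𝔸 (f j).toKIdx) (OA : ∀ j : J, BondOpY 𝔸 (f j).toKIdx)
  (ops : ∀ x : MemberY d ℓ hd hL b₀ b₁ Mstar, OperatorLayerY d ℓ hd hL b₀ b₁ Mstar 𝔸 G x)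

/-- ★★★ **THE [B9] CARRIER BUNDLE OVER THE CODED CARRIER WITH THE CODED CLASS (3.37) A PARAMETER**: node00-def-Y's `carriersYUParH` verbatim (index `J`, geometry
`geo9Y (f j)`, `G′ := KSCUPar … (parA j) (parH j) …`, `G := KACU … (OA j) parBY …`, `C⁻¹ := pullS … (CinvY P f G parA j)`, analyticity `IsAnKY … (parA j) b …`, the operator
layer's rows 15–26 read along the decoding) with the backgrounds coded by `codingYx P G (f j) (C37 j) (C38 j)` — the class (3.37) the Sect.-B step is proved on is the
caller's (`C37GY …` for the straight transporter, `C37KY …` for print's knit transporter).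
[cite: Balaban1985BackgroundPropagators, Thm 3.4 p.400 («extend … as analytic functions of A»), (3.35)–(3.38) p.396, (3.115) p.418, Thms 3.1–3.15 pp.397–432 (the carriers)] -/
def carriersYUParHX : PrintedCarriers9X where
  I9 := J
  d9 := d + 1
  c35 := c35Y
  geo9 := fun j => geo9Y (f j)
  bg9 := fun j => (codingYx P G (f j) (C37 j) (C38 j)).bg
  InCube := fun j => InCubeY (f j)
  Gp := fun j => KSCUPar P G (f j) (parA j) (parH j) (C37 j) (C38 j)
  GA := fun j => KACU P G (f j) (OA j) (parBY (f j).toKIdx) (C37 j) (C38 j)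
  Cinv := fun j => pullS (codingYx P G (f j) (C37 j) (C38 j)) (CinvY P f G parA j)
  IsAnalyticExt := fun j => IsAnKY P G (f j) (parA j) b (C37 j) (C38 j)
  E37 := fun j => pullRW (codingYx P G (f j) (C37 j) (C38 j)) (rwExpansionR (regC335 𝔸 G P) (regC336 𝔸 G P) (ops (f j)).E37)
  EK39 := fun j => pullRWK (codingYx P G (f j) (C37 j) (C38 j)) (rwKernelExpansionR (regC335 𝔸 G P) (regC336 𝔸 G P) (ops (f j)).EK39)
  E310 := fun j => pullRW (codingYx P G (f j) (C37 j) (C38 j)) (rwExpansionR (regC335 𝔸 G P) (regC336 𝔸 G P) (ops (f j)).E310)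
  PosDef := fun j n => pullC (codingYx P G (f j) (C37 j) (C38 j)) ((ops (f j)).PosDef n)
  GD := fun j => pullK (codingYx P G (f j) (C37 j) (C38 j)) (kernelFamilyR (regC335 𝔸 G P) (regC336 𝔸 G P) (ops (f j)).GD)
  G₁ := fun j => pullK (codingYx P G (f j) (C37 j) (C38 j)) (kernelFamilyR (regC335 𝔸 G P) (regC336 𝔸 G P) (ops (f j)).G₁)
  H := fun j => pullH (codingYx P G (f j) (C37 j) (C38 j)) (hKernelR (regC335 𝔸 G P) (regC336 𝔸 G P) (ops (f j)).H)
  H₁ := fun j => pullH (codingYx P G (f j) (C37 j) (C38 j)) (hKernelR (regC335 𝔸 G P) (regC336 𝔸 G P) (ops (f j)).H₁)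
  HasRWExp := fun j => pullPK (codingYx P G (f j) (C37 j) (C38 j)) (fun K => (ops (f j)).HasRWExp (kernelFamilyRY K))
  HasRWExpH := fun j => pullPH (codingYx P G (f j) (C37 j) (C38 j)) (fun K => (ops (f j)).HasRWExpH (hKernelRY K))
  PosDefK := fun j => pullPK₀ (codingYx P G (f j) (C37 j) (C38 j)) (fun K => (ops (f j)).PosDefK (kernelFamilyRY K))
  GG := fun j => pullK (codingYx P G (f j) (C37 j) (C38 j)) (kernelFamilyR (regC335 𝔸 G P) (regC336 𝔸 G P) (ops (f j)).GG)
  Kdiff := fun j => pullK (codingYx P G (f j) (C37 j) (C38 j)) (kernelFamilyR (regC335 𝔸 G P) (regC336 𝔸 G P) (ops (f j)).Kdiff)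
  dOmega := fun j => dOmegaY (f j)
  Ck := fun j => pullS (codingYx P G (f j) (C37 j) (C38 j)) (siteKernelR (regC335 𝔸 G P) (regC336 𝔸 G P) (ops (f j)).Ck)
  inΛ := fun j => inΛY (f j)
  unitDist := fun j => unitDistY (f j)
  GivenBy3185 := fun j => pullC (codingYx P G (f j) (C37 j) (C38 j)) (ops (f j)).GivenBy3185
  HasRWExpC := fun j => pullC (codingYx P G (f j) (C37 j) (C38 j)) (ops (f j)).HasRWExpC
  P349 := fun j => pullF (codingYx P G (f j) (C37 j) (C38 j)) (fineKernelR (regC335 𝔸 G P) (regC336 𝔸 G P) (ops (f j)).P349)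
  QGQinv := fun j => pullS (codingYx P G (f j) (C37 j) (C38 j)) (siteKernelR (regC335 𝔸 G P) (regC336 𝔸 G P) (ops (f j)).QGQinv)
  QG1Qinv := fun j => pullS (codingYx P G (f j) (C37 j) (C38 j)) (siteKernelR (regC335 𝔸 G P) (regC336 𝔸 G P) (ops (f j)).QG1Qinv)
  OmK := fun j => OmKY (f j)

/-- ★ **EDITION 2 IS THE INSTANCE AT THE EXTENDED STRAIGHT CLASS** (`C37 := fun j => C37GY G (f j) (ιB j) (cqY d)`), `rfl`.
[cite: Balaban1985BackgroundPropagators, (3.37) p.396, Thm 3.4 p.400, bookkeeping] -/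
theorem carriersYUParH_eq_carriersYUParHX :
    carriersYUParH P G f b ιB C38 parA parH OA ops = carriersYUParHX P G f b (fun j => C37GY G (f j) (ιB j) (cqY d)) C38 parA parH OA ops := rfl

/-- edition 1 (the diagonal instance `parA = parH`) is the instance at the extended straight class likewise (`rfl`). [cite: Balaban1985BackgroundPropagators, (3.37) p.396, (3.21) p.394, (3.40) p.397, bookkeeping] -/
theorem carriersYUPar_eq_carriersYUParHX (par : ∀ j : J, SiteParY 𝔸 (f j).toKIdx) :
    carriersYUPar P G f b ιB C38 par OA ops = carriersYUParHX P G f b (fun j => C37GY G (f j) (ιB j) (cqY d)) C38 par par OA ops := rfl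

/-! ### §1a. Faces (`rfl` ∕ `Iff.rfl`), as in `Node00.CarriersYUParH` §2–§2c -/

/-- the index of the bundle is `J`. [cite: Balaban1985BackgroundPropagators, p.399 (the family), bookkeeping] -/
theorem carriersYUParHX_I9 : (carriersYUParHX P G f b C37 C38 parA parH OA ops).I9 = J := rfl
/-- the (3.35) threshold of the bundle is `c35Y`. [cite: Balaban1985BackgroundPropagators, p.396 («≧ 10»), bookkeeping] -/
theorem carriersYUParHX_c35 : (carriersYUParHX P G f b C37 C38 parA parH OA ops).c35 = c35Y := rfl
/-- the geometry at `j` is the member `f j`'s. [cite: Balaban1985BackgroundPropagators, Sect. A pp.396–397, bookkeeping] -/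
theorem carriersYUParHX_geo9 (j : J) : (carriersYUParHX P G f b C37 C38 parA parH OA ops).geo9 j = geo9Y (f j) := rfl
/-- … spelled through `codingYx`. [cite: Balaban1985BackgroundPropagators, (3.37)–(3.38) p.396, bookkeeping] -/
theorem carriersYUParHX_bg9_eq (j : J) : (carriersYUParHX P G f b C37 C38 parA parH OA ops).bg9 j = (codingYx P G (f j) (C37 j) (C38 j)).bg := rfl
/-- **`G′` at `j` is the U-letter site reading `KSCU` at the transporter parameters `parA j` (averaging), `parH j` (Hölder).** [cite: Balaban1985BackgroundPropagators, Thm 3.4 p.400, (3.42)–(3.47) pp.397–398] -/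
theorem carriersYUParHX_Gp (j : J) :
    (carriersYUParHX P G f b C37 C38 parA parH OA ops).Gp j = KSCUPar P G (f j) (parA j) (parH j) (C37 j) (C38 j) := rfl
/-- **`G` at `j` is the U-letter bond reading `KACU`** at the bond-average letter parameter `OA j`, `parBY`. [cite: Balaban1985BackgroundPropagators, Thm 3.4 p.400, (3.84)–(3.86) p.407] -/
theorem carriersYUParHX_GA (j : J) :
    (carriersYUParHX P G f b C37 C38 parA parH OA ops).GA j = KACU P G (f j) (OA j)
      (parBY (f j).toKIdx) (C37 j) (C38 j) := rfl
/-- `C⁻¹` at `j` is the class-parametric kernel `CinvY P` (`B9SectBKerFrameCodedYR`, bundle `B9SectBCodedChainR4`) at the averaging parameter `parA`, read along the decoding, BY NAME (`rfl`). [cite: Balaban1985BackgroundPropagators, Cor. 3.6 p.408, bookkeeping] -/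
theorem carriersYUParHX_Cinv (j : J) :
    (carriersYUParHX P G f b C37 C38 parA parH OA ops).Cinv j = pullS (codingYx P G (f j) (C37 j) (C38 j)) (CinvY P f G parA j) := rfl
/-- **the analyticity slot at `j` is `IsAnKY … b`.** [cite: Balaban1985BackgroundPropagators, Thm 3.4 p.400 («extend … as analytic functions of A»)] -/
theorem carriersYUParHX_IsAnalyticExt (j : J) :
    (carriersYUParHX P G f b C37 C38 parA parH OA ops).IsAnalyticExt j = IsAnKY P G (f j) (parA j) b (C37 j) (C38 j) := rfl
/-- … i.e. the class-parametric member carrier's (3.35) at `U`. [cite: Balaban1985BackgroundPropagators, (3.35) p.396, bookkeeping] -/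
theorem carriersYUParHX_bg9_Reg335_base_iff_bg9YC (j : J) (c α₀ : ℝ) (U : CfgY 𝔸 (f j).toKIdx) :
    ((carriersYUParHX P G f b C37 C38 parA parH OA ops).bg9 j).Reg335 c α₀ (.base U) ↔ (bg9YC 𝔸 G P (f j)).Reg335 c α₀ U := Iff.rfl
/-- **(3.37) of the coded carrier between a base code and a multiplier code READS THE PARAMETER CLASS `C37 j`.** [cite: Balaban1985BackgroundPropagators, (3.37) p.396] -/
theorem carriersYUParHX_bg9_Cplx337_base_mult_iff (j : J) (α : ℝ) (U : CfgY 𝔸 (f j).toKIdx) (a : AfldY 𝔸 (f j).toKIdx) :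
    ((carriersYUParHX P G f b C37 C38 parA parH OA ops).bg9 j).Cplx337 α (.base U) (.mult a) ↔ C37 j α U a := Iff.rfl
/-- **(3.38) of the coded carrier between a base code and a multiplier code READS the parameter class `C38 j`.** [cite: Balaban1985BackgroundPropagators, (3.38) p.396] -/
theorem carriersYUParHX_bg9_Cplx338_base_mult_iff (j : J) (α : ℝ) (U : CfgY 𝔸 (f j).toKIdx) (a : AfldY 𝔸 (f j).toKIdx) :
    ((carriersYUParHX P G f b C37 C38 parA parH OA ops).bg9 j).Cplx338 α (.base U) (.mult a) ↔ C38 j α U a := Iff.rfl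

end Bundle

/-! ## §2. At the record: `M_N(ℂ)`, `SU(N)` — `Y9OfRecordUParHX`, `Y9OfRecordUPbParHX` -/

section Record

variable (N : ℕ)

/-- ★★ **THE [B9] CARRIER BUNDLE OF RECORD OVER THE CODED CARRIER WITH THE CODED CLASS A PARAMETER**: `carriersYUParHX` at `M_N(ℂ)`, `SU(N)` (cf. `Y9OfRecordUParH`).
[cite: Balaban1985BackgroundPropagators, Thm 3.4 p.400, (3.37)–(3.38) p.396, (3.115) p.418, Thms 3.1–3.15 pp.397–432] -/
def Y9OfRecordUParHX (θ : Stage3Params) (Mstar : ℕ) (P : RegExtraY θ.d₆ θ.ℓ₆ θ.hd' θ.hL' θ.b₀ θ.b₁ Mstar (Matrix (Fin N) (Fin N) ℂ)) (ops : OpsY N θ Mstar) {J : Type}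
    (f : J → MemberY θ.d₆ θ.ℓ₆ θ.hd' θ.hL' θ.b₀ θ.b₁ Mstar) {ι : Type} [Fintype ι] (b : Module.Basis ι ℝ (Matrix (Fin N) (Fin N) ℂ))
    (C37 C38 : ∀ j : J, ℝ → CfgY (Matrix (Fin N) (Fin N) ℂ) (f j).toKIdx → AfldY (Matrix (Fin N) (Fin N) ℂ) (f j).toKIdx → Prop)
    (parA parH : ∀ j : J, SiteParY (Matrix (Fin N) (Fin N) ℂ) (f j).toKIdx) (OA : ∀ j : J, BondOpY (Matrix (Fin N) (Fin N) ℂ) (f j).toKIdx) : PrintedCarriers9X :=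
  carriersYUParHX P (specialUnitaryUnits (Fin N)) f b C37 C38 parA parH OA ops

/-- ★★ **… AT THE RECORD's READING OF PRINT's CLASS (3.35)–(3.36)** (`P := extraYPb (M_N ℂ) SU(N)`; cf. `Y9OfRecordUPbParH`): NAMES the class instance; asserts nothing
about it. [cite: Balaban1985BackgroundPropagators, (3.35)–(3.36) p.396 («O(1) … a number ≧ 10»), Thm 3.4 p.400] -/
def Y9OfRecordUPbParHX (θ : Stage3Params) (Mstar : ℕ) (ops : OpsY N θ Mstar) {J : Type} (f : J → MemberY θ.d₆ θ.ℓ₆ θ.hd' θ.hL' θ.b₀ θ.b₁ Mstar)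
    {ι : Type} [Fintype ι] (b : Module.Basis ι ℝ (Matrix (Fin N) (Fin N) ℂ))
    (C37 C38 : ∀ j : J, ℝ → CfgY (Matrix (Fin N) (Fin N) ℂ) (f j).toKIdx → AfldY (Matrix (Fin N) (Fin N) ℂ) (f j).toKIdx → Prop)
    (parA parH : ∀ j : J, SiteParY (Matrix (Fin N) (Fin N) ℂ) (f j).toKIdx) (OA : ∀ j : J, BondOpY (Matrix (Fin N) (Fin N) ℂ) (f j).toKIdx) : PrintedCarriers9X :=
  Y9OfRecordUParHX N θ Mstar (extraYPb (Matrix (Fin N) (Fin N) ℂ) (specialUnitaryUnits (Fin N))) ops f b C37 C38 parA parH OA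

variable {N}
variable (θ : Stage3Params) (Mstar : ℕ) (P : RegExtraY θ.d₆ θ.ℓ₆ θ.hd' θ.hL' θ.b₀ θ.b₁ Mstar (Matrix (Fin N) (Fin N) ℂ)) (ops : OpsY N θ Mstar) {J : Type}
  (f : J → MemberY θ.d₆ θ.ℓ₆ θ.hd' θ.hL' θ.b₀ θ.b₁ Mstar) {ι : Type} [Fintype ι] (b : Module.Basis ι ℝ (Matrix (Fin N) (Fin N) ℂ))
  (ιB : ∀ j : J, BlkY (f j).toKIdx → IBondY (f j).toKIdx)
  (C37 C38 : ∀ j : J, ℝ → CfgY (Matrix (Fin N) (Fin N) ℂ) (f j).toKIdx → AfldY (Matrix (Fin N) (Fin N) ℂ) (f j).toKIdx → Prop)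
  (parA parH : ∀ j : J, SiteParY (Matrix (Fin N) (Fin N) ℂ) (f j).toKIdx) (OA : ∀ j : J, BondOpY (Matrix (Fin N) (Fin N) ℂ) (f j).toKIdx)

/-- ★ node00-def-Y's `Y9OfRecordUParH` IS the instance at the extended straight class (`rfl`). [cite: Balaban1985BackgroundPropagators, (3.37) p.396, Thm 3.4 p.400, bookkeeping] -/
theorem Y9OfRecordUParH_eq_Y9OfRecordUParHX : Y9OfRecordUParH N θ Mstar P ops f b ιB C38 parA parH OA =
    Y9OfRecordUParHX N θ Mstar P ops f b (fun j => C37GY (specialUnitaryUnits (Fin N)) (f j) (ιB j) (cqY θ.d₆)) C38 parA parH OA := rfl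
/-- ★ node00-def-Y's `Y9OfRecordUPbParH` IS the instance at the extended straight class (`rfl`). [cite: Balaban1985BackgroundPropagators, (3.37) p.396, Thm 3.4 p.400, bookkeeping] -/
theorem Y9OfRecordUPbParH_eq_Y9OfRecordUPbParHX : Y9OfRecordUPbParH N θ Mstar ops f b ιB C38 parA parH OA =
    Y9OfRecordUPbParHX N θ Mstar ops f b (fun j => C37GY (specialUnitaryUnits (Fin N)) (f j) (ιB j) (cqY θ.d₆)) C38 parA parH OA := rfl
/-- `Y9OfRecordUParHX` unfolded (`rfl`). [cite: Balaban1985BackgroundPropagators, Thm 3.4 p.400, bookkeeping] -/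
theorem Y9OfRecordUParHX_eq : Y9OfRecordUParHX N θ Mstar P ops f b C37 C38 parA parH OA = carriersYUParHX P (specialUnitaryUnits (Fin N)) f b C37 C38 parA parH OA ops := rfl
/-- `Y9OfRecordUPbParHX` unfolded through `carriersYUParHX` (`rfl`). [cite: Balaban1985BackgroundPropagators, (3.35) p.396, bookkeeping] -/
theorem Y9OfRecordUPbParHX_eq_carriersYUParHX : Y9OfRecordUPbParHX N θ Mstar ops f b C37 C38 parA parH OA =
    carriersYUParHX (extraYPb (Matrix (Fin N) (Fin N) ℂ) (specialUnitaryUnits (Fin N))) (specialUnitaryUnits (Fin N)) f b C37 C38 parA parH OA ops := rfl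
/-- the geometry of record at `j` is the record bundle's at `f j`. [cite: Balaban1985BackgroundPropagators, Sect. A pp.396–397, bookkeeping] -/
theorem Y9OfRecordUPbParHX_geo9 (j : J) : (Y9OfRecordUPbParHX N θ Mstar ops f b C37 C38 parA parH OA).geo9 j = (Y9OfRecordP N θ Mstar ops).geo9 (f j) := rfl
/-- **`G′` of record at `j`** = `KSCUPar` at `SU(N)`, `parA j`, `parH j`, class `C37 j`. [cite: Balaban1985BackgroundPropagators, Thm 3.4 p.400] -/
theorem Y9OfRecordUPbParHX_Gp (j : J) : (Y9OfRecordUPbParHX N θ Mstar ops f b C37 C38 parA parH OA).Gp j =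
    KSCUPar (extraYPb (Matrix (Fin N) (Fin N) ℂ) (specialUnitaryUnits (Fin N))) (specialUnitaryUnits (Fin N)) (f j) (parA j) (parH j) (C37 j) (C38 j) := rfl
/-- **(3.35) of the bundle of record at a base code, SPELLED OUT** (as `Y9OfRecordUPbParH_bg9_Reg335_base_iff`): the class of a BASE code does not read `C37`.
[cite: Balaban1985BackgroundPropagators, (3.35) p.396 («|U(∂p) − 1| < α₀ M … O(1)»)] -/
theorem Y9OfRecordUPbParHX_bg9_Reg335_base_iff (j : J) (c α₀ : ℝ) (U : CfgY (Matrix (Fin N) (Fin N) ℂ) (f j).toKIdx) :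
    ((Y9OfRecordUPbParHX N θ Mstar ops f b C37 C38 parA parH OA).bg9 j).Reg335 c α₀ (.base U) ↔
      (bg9YC (Matrix (Fin N) (Fin N) ℂ) (specialUnitaryUnits (Fin N)) (extraYPb (Matrix (Fin N) (Fin N) ℂ) (specialUnitaryUnits (Fin N))) (f j)).Reg335 c α₀ U := Iff.rfl
/-- **(3.37) of the bundle of record between a base code and a multiplier code READS THE PARAMETER CLASS `C37 j`.** [cite: Balaban1985BackgroundPropagators, (3.37) p.396] -/
theorem Y9OfRecordUPbParHX_bg9_Cplx337_base_mult_iff (j : J) (α : ℝ) (U : CfgY (Matrix (Fin N) (Fin N) ℂ) (f j).toKIdx) (a : AfldY (Matrix (Fin N) (Fin N) ℂ) (f j).toKIdx) :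
    ((Y9OfRecordUPbParHX N θ Mstar ops f b C37 C38 parA parH OA).bg9 j).Cplx337 α (.base U) (.mult a) ↔ C37 j α U a := Iff.rfl

end Record

/-! ## §3. ★★★ Leaf edition 3: the leaf over the coded carrier with the two transporters, AT THE PARAMETER CLASS -/

section Knit

variable {𝔸 : Type} [NormedRing 𝔸] (P : RegExtraY d ℓ hd hL b₀ b₁ Mstar 𝔸) [NormedAlgebra ℂ 𝔸] [CompleteSpace 𝔸] (G : Subgroup 𝔸ˣ)
  {J : Type} (f : J → MemberY d ℓ hd hL b₀ b₁ Mstar)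
  (C38 : ∀ j : J, ℝ → CfgY 𝔸 (f j).toKIdx → AfldY 𝔸 (f j).toKIdx → Prop)
  {ι : Type} [Fintype ι] (b : Module.Basis ι ℝ 𝔸) (C37 : ∀ j : J, ℝ → CfgY 𝔸 (f j).toKIdx → AfldY 𝔸 (f j).toKIdx → Prop)
  (parA parH : ∀ j : J, SiteParY 𝔸 (f j).toKIdx) (OA : ∀ j : J, BondOpY 𝔸 (f j).toKIdx)
  (ops : ∀ x : MemberY d ℓ hd hL b₀ b₁ Mstar, OperatorLayerY d ℓ hd hL b₀ b₁ Mstar 𝔸 G x)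

/-- ★★★ **`B9LeafX (carriersYUParHX P G f b C37 C38 parA parH OA ops)` — THE [B9] LEAF OVER THE CODED CARRIER WITH THE AVERAGING TRANSPORTER `parA`, THE HÖLDER
TRANSPORTER `parH`, THE BOND-AVERAGE LETTER `OA`, AT THE PARAMETER CLASS `C37`** (leaf edition 3 = dag-n06-d's `b9LeafX_carriersYUParH` with the coded Sect.-B step
`hB : … → SectBStepUPar P f (d+1) c35Y G b parA parH OA … C37 C38 …` read at the caller's class): `hone`, the `U = 1` comparisons, the null readings, the residual
entries, the three letter pins `hGpPin ∕ hGAPin ∕ hCinvPin`, rows 15–26 at `(regC335 P, regC336 P)` and the [B6] block VERBATIM; proof verbatim.  Instances: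
`C37 := fun j => C37GY …` = edition 2 (`carriersYUParH_eq_carriersYUParHX`, `rfl`); `C37 := fun j => C37KY …` with `(parA, parH) := (parKnitY, parSymY)` = the knit
certificate's leaf, whose `hB` is then `Summit.….N06SectBStepUParKnitRecord.sectBStepUPar_knitRecord`.
[cite: Balaban1985BackgroundPropagators, Thms 3.1–3.15 pp.397–432, Thm 3.4 p.400, Cor. 3.5 proof p.407, p.410, (3.19) p.393, (3.21) p.394, (3.40) p.397, (3.35)–(3.37) p.396; Balaban1985Averaging, Prop. 2 p.26; Balaban1984PropagatorsII, Props. 2.2, 2.3, 2.6] -/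
theorem b9LeafX_carriersYUParHX (δ₀ : ℝ) {Jt Kt : Type} (tree : Jt → B6.TreeData) (loc : Kt → B6.LocalOp)
    (hone : ∀ (j : J) (α₀ : ℝ), 0 < α₀ → regC335 𝔸 G P (f j) c35Y α₀ (bg9YC 𝔸 G P (f j)).one)
    (hGp_e : ∀ (x : MemberY d ℓ hd hL b₀ b₁ Mstar) (n : Fin 4) (lam : (geo9Y x).Loc) (y : (geo9Y x).Site),
      (ops x).Gp.e n (bg9Y 𝔸 G x).one lam y ≤ (Node00.GpU x.toKIdx).e n lam y)
    (hGp_h1 : ∀ (x : MemberY d ℓ hd hL b₀ b₁ Mstar) (lam : (geo9Y x).Loc) (b : ℝ) (ζ : (geo9Y x).Cut),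
      (ops x).Gp.h1 (bg9Y 𝔸 G x).one lam b ζ ≤ (Node00.GpU x.toKIdx).h1 lam b ζ)
    (hC : ∀ (x : MemberY d ℓ hd hL b₀ b₁ Mstar) (y y' : (geo9Y x).Site), |(ops x).Cinv.ker (bg9Y 𝔸 G x).one y y'| ≤ |(Node00.CinvU x.toKIdx).ker y y'|)
    (hGA_e : ∀ (x : MemberY d ℓ hd hL b₀ b₁ Mstar) (n : Fin 4) (lam : (geo9Y x).Loc) (y : (geo9Y x).Site),
      (ops x).GA.e n (bg9Y 𝔸 G x).one lam y ≤ (Node00.GU x.toKIdx).e n lam y)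
    (hGA_h1 : ∀ (x : MemberY d ℓ hd hL b₀ b₁ Mstar) (lam : (geo9Y x).Loc) (b : ℝ) (ζ : (geo9Y x).Cut),
      (ops x).GA.h1 (bg9Y 𝔸 G x).one lam b ζ ≤ (Node00.GU x.toKIdx).h1 lam b ζ)
    (hGA_e4 : ∀ (x : MemberY d ℓ hd hL b₀ b₁ Mstar) (lam : (geo9Y x).Loc) (y : (geo9Y x).Site),
      (ops x).GA.e4 (bg9Y 𝔸 G x).one lam y ≤ (Node00.GU x.toKIdx).e4 lam y)
    (hGA_h2 : ∀ (x : MemberY d ℓ hd hL b₀ b₁ Mstar) (lam : (geo9Y x).Loc) (b : ℝ) (ζ : (geo9Y x).Cut),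
      (ops x).GA.h2 (bg9Y 𝔸 G x).one lam b ζ ≤ (Node00.GU x.toKIdx).h2 lam b ζ)
    (hGA_l2 : ∀ (x : MemberY d ℓ hd hL b₀ b₁ Mstar) (n : Fin 6) (lam : (geo9Y x).Loc) (h : (geo9Y x).Cut),
      (ops x).GA.l2 n (bg9Y 𝔸 G x).one lam h ≤ (Node00.GU x.toKIdx).l2 n lam h)
    (hE4 : ∀ (x : MemberY d ℓ hd hL b₀ b₁ Mstar) (lam : (geo9Y x).Loc), ¬ (lam.isRight = true) → ∀ y, (ops x).GA.e4 (bg9Y 𝔸 G x).one lam y ≤ 0)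
    (hH2 : ∀ (x : MemberY d ℓ hd hL b₀ b₁ Mstar) (lam : (geo9Y x).Loc), ¬ (lam.isRight = true) →
      ∀ (β : ℝ) (ζ : (geo9Y x).Cut), (ops x).GA.h2 (bg9Y 𝔸 G x).one lam β ζ ≤ 0)
    (hGp : B9FromB6.ResidualGpAtOne geo9Y (bg9YR 𝔸 G (regC335 𝔸 G P) (regC336 𝔸 G P)) (fun x => kernelFamilyR (regC335 𝔸 G P) (regC336 𝔸 G P) (ops x).Gp))
    (hGA : B9FromB6.ResidualGAGlobAtOne geo9Y (bg9YR 𝔸 G (regC335 𝔸 G P) (regC336 𝔸 G P)) (fun x => kernelFamilyR (regC335 𝔸 G P) (regC336 𝔸 G P) (ops x).GA))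
    (hGpPin : ∀ j : J, kernelFamilyR (regC335 𝔸 G P) (regC336 𝔸 G P) (ops (f j)).Gp =
      kernelFamilyS (f j).toKIdx (bg9YC 𝔸 G P (f j)) (fun U => U) (GpY (f j).toKIdx (parA j)) (parH j))
    (hGAPin : ∀ j : J, kernelFamilyR (regC335 𝔸 G P) (regC336 𝔸 G P) (ops (f j)).GA =
      kernelFamilyB (f j).toKIdx (bg9YC 𝔸 G P (f j)) (fun U => U)
        (OA j) (parBY (f j).toKIdx))
    (hCinvPin : ∀ j : J, siteKernelR (regC335 𝔸 G P) (regC336 𝔸 G P) (ops (f j)).Cinv = CinvY P f G parA j)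
    (hB : B9.Thm32Printed (d + 1) c35Y (fun j => geo9Y (f j)) (fun j => bg9YC 𝔸 G P (f j)) (CinvY P f G parA) →
      B9.Thm33Printed c35Y (fun j => geo9Y (f j)) (fun j => bg9YC 𝔸 G P (f j))
        (fun j => kernelFamilyS (f j).toKIdx (bg9YC 𝔸 G P (f j)) (fun U => U) (GpY (f j).toKIdx (parA j)) (parH j))
        (fun j => kernelFamilyB (f j).toKIdx (bg9YC 𝔸 G P (f j)) (fun U => U)
          (OA j) (parBY (f j).toKIdx)) →
      SectBStepUPar P f (d + 1) c35Y G b parA parH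
        OA (fun j => parBY (f j).toKIdx)
        C37 C38 (CinvY P f G parA))
    (t37 : B9.Thm37Printed c35Y geo9Y (bg9YR 𝔸 G (regC335 𝔸 G P) (regC336 𝔸 G P)) (fun x => rwExpansionR (regC335 𝔸 G P) (regC336 𝔸 G P) (ops x).E37))
    (c38 : B9.Cor38Printed c35Y geo9Y (bg9YR 𝔸 G (regC335 𝔸 G P) (regC336 𝔸 G P)) (fun x => rwExpansionR (regC335 𝔸 G P) (regC336 𝔸 G P) (ops x).E37))
    (t39 : B9.Thm39Printed (d + 1) c35Y geo9Y (bg9YR 𝔸 G (regC335 𝔸 G P) (regC336 𝔸 G P))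
      (fun x => rwKernelExpansionR (regC335 𝔸 G P) (regC336 𝔸 G P) (ops x).EK39))
    (t310 : B9.Thm310Printed c35Y geo9Y (bg9YR 𝔸 G (regC335 𝔸 G P) (regC336 𝔸 G P)) (fun x => rwExpansionR (regC335 𝔸 G P) (regC336 𝔸 G P) (ops x).E310))
    (hsum : B9.RWSumsYieldIneqs geo9Y (bg9YR 𝔸 G (regC335 𝔸 G P) (regC336 𝔸 G P)) (fun x => rwExpansionR (regC335 𝔸 G P) (regC336 𝔸 G P) (ops x).E37)
      (fun x => rwExpansionR (regC335 𝔸 G P) (regC336 𝔸 G P) (ops x).E310) (fun x => kernelFamilyR (regC335 𝔸 G P) (regC336 𝔸 G P) (ops x).Gp)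
      (fun x => kernelFamilyR (regC335 𝔸 G P) (regC336 𝔸 G P) (ops x).GA))
    (hksum : B9.RWKernelSumYields (d + 1) geo9Y (bg9YR 𝔸 G (regC335 𝔸 G P) (regC336 𝔸 G P))
      (fun x => rwKernelExpansionR (regC335 𝔸 G P) (regC336 𝔸 G P) (ops x).EK39) (fun x => siteKernelR (regC335 𝔸 G P) (regC336 𝔸 G P) (ops x).Cinv))
    (t311 : B9.Thm311Printed c35Y geo9Y (bg9YR 𝔸 G (regC335 𝔸 G P) (regC336 𝔸 G P)) (fun x => (ops x).PosDef))
    (t312 : B9.Thm312Printed (d + 1) c35Y geo9Y (bg9YR 𝔸 G (regC335 𝔸 G P) (regC336 𝔸 G P))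
      (fun x => kernelFamilyR (regC335 𝔸 G P) (regC336 𝔸 G P) (ops x).GD) (fun x => kernelFamilyR (regC335 𝔸 G P) (regC336 𝔸 G P) (ops x).G₁)
      (fun x => hKernelR (regC335 𝔸 G P) (regC336 𝔸 G P) (ops x).H) (fun x => hKernelR (regC335 𝔸 G P) (regC336 𝔸 G P) (ops x).H₁)
      (fun x K => (ops x).HasRWExp (kernelFamilyRY K)) (fun x K => (ops x).HasRWExpH (hKernelRY K)) (fun x K => (ops x).PosDefK (kernelFamilyRY K)))
    (t313 : B9.Thm313Printed c35Y geo9Y (bg9YR 𝔸 G (regC335 𝔸 G P) (regC336 𝔸 G P)) (fun x => kernelFamilyR (regC335 𝔸 G P) (regC336 𝔸 G P) (ops x).GG)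
      (fun x K => (ops x).HasRWExp (kernelFamilyRY K)) (fun x K => (ops x).PosDefK (kernelFamilyRY K)))
    (t314 : B9.Thm314Printed c35Y geo9Y (bg9YR 𝔸 G (regC335 𝔸 G P) (regC336 𝔸 G P)) (fun x => kernelFamilyR (regC335 𝔸 G P) (regC336 𝔸 G P) (ops x).Kdiff)
      dOmegaY)
    (t315 : B9.Thm315FullPrinted c35Y geo9Y (bg9YR 𝔸 G (regC335 𝔸 G P) (regC336 𝔸 G P)) (fun x => siteKernelR (regC335 𝔸 G P) (regC336 𝔸 G P) (ops x).Ck)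
      inΛY unitDistY (fun x => (ops x).GivenBy3185) (fun x => (ops x).HasRWExpC))
    (s349 : B9.Stmt349Printed (d + 1) c35Y geo9Y (bg9YR 𝔸 G (regC335 𝔸 G P) (regC336 𝔸 G P))
      (fun x => fineKernelR (regC335 𝔸 G P) (regC336 𝔸 G P) (ops x).P349))
    (s3132 : B9.Stmt3132Printed (d + 1) c35Y geo9Y (bg9YR 𝔸 G (regC335 𝔸 G P) (regC336 𝔸 G P))
      (fun x => siteKernelR (regC335 𝔸 G P) (regC336 𝔸 G P) (ops x).QGQinv) (fun x => siteKernelR (regC335 𝔸 G P) (regC336 𝔸 G P) (ops x).QG1Qinv))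
    (t314loc : B9Thm314.Thm314LocalPrinted c35Y geo9Y (bg9YR 𝔸 G (regC335 𝔸 G P) (regC336 𝔸 G P))
      (fun x => kernelFamilyR (regC335 𝔸 G P) (regC336 𝔸 G P) (ops x).Kdiff) OmKY dOmegaY)
    (h6 : B6BlockParam (Node00.towerBlockOfRecord d ℓ hd hL b₀ b₁ δ₀ tree loc)) :
    B9LeafX (carriersYUParHX P G f b C37 C38 parA parH OA ops) := by
  -- (1) at the record, over the full member family at the classes `(regC335 P, regC336 P)`: the `U ≡ 1` block from [B6], Thms 3.1 ∕ 3.2 ∕ 3.3 from rows 15–19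
  have hbaseR : B9.BaseU1Printed (d + 1) geo9Y (bg9YR 𝔸 G (regC335 𝔸 G P) (regC336 𝔸 G P))
      (fun x => kernelFamilyR (regC335 𝔸 G P) (regC336 𝔸 G P) (ops x).Gp) (fun x => kernelFamilyR (regC335 𝔸 G P) (regC336 𝔸 G P) (ops x).GA)
      (fun x => siteKernelR (regC335 𝔸 G P) (regC336 𝔸 G P) (ops x).Cinv) :=
    baseU1_of_b6BlockParam_on (carriersYR d ℓ hd hL b₀ b₁ Mstar 𝔸 G (regC335 𝔸 G P) (regC336 𝔸 G P) ops).toPrintedCarriers9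
      (Node00.towerBlockOfRecord d ℓ hd hL b₀ b₁ δ₀ tree loc) rfl (fun x => ⟨x.toKIdx, x.hcfk⟩)
      (fun x => dictAtOneY x (kernelFamilyR (regC335 𝔸 G P) (regC336 𝔸 G P) (ops x).Gp) (kernelFamilyR (regC335 𝔸 G P) (regC336 𝔸 G P) (ops x).GA)
        (siteKernelR (regC335 𝔸 G P) (regC336 𝔸 G P) (ops x).Cinv) (hGp_e x) (hGp_h1 x) (hC x) (hGA_e x) (hGA_h1 x) (hGA_e4 x) (hGA_h2 x) (hGA_l2 x))
      (fun _ => fun lam => lam.isRight = true) (fun x => B9GeoNormsKLevelModelSignsV1.modelSignsOn_geo9K x.toKIdx) hE4 hH2 hGp hGA h6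
  have h31R := B9.thm31_of_thm37 c35Y geo9Y (bg9YR 𝔸 G (regC335 𝔸 G P) (regC336 𝔸 G P)) _ _ _ _ t37 hsum
  have h32R := B9.thm32_of_thm39 (d + 1) c35Y geo9Y (bg9YR 𝔸 G (regC335 𝔸 G P) (regC336 𝔸 G P)) _ _ t39 hksum
  have h33R := B9.thm33_of_thm37_310 c35Y geo9Y (bg9YR 𝔸 G (regC335 𝔸 G P) (regC336 𝔸 G P)) _ _ _ _ t37 t310 hsum
  -- (2) along the subfamily, re-keyed to NODE 00's letter readings by the pins
  have eGp := funext hGpPin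
  have eGA := funext hGAPin
  have eC := funext hCinvPin
  have hbaseJ := baseU1Printed_reindex f (d + 1) geo9Y (bg9YR 𝔸 G (regC335 𝔸 G P) (regC336 𝔸 G P)) _ _ _ hbaseR
  have h31J := thm31Printed_reindex f c35Y geo9Y (bg9YR 𝔸 G (regC335 𝔸 G P) (regC336 𝔸 G P)) _ h31R
  have h32J := thm32Printed_reindex f (d + 1) c35Y geo9Y (bg9YR 𝔸 G (regC335 𝔸 G P) (regC336 𝔸 G P)) _ h32R
  have h33J := thm33Printed_reindex f c35Y geo9Y (bg9YR 𝔸 G (regC335 𝔸 G P) (regC336 𝔸 G P)) _ _ h33R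
  rw [eGp, eGA, eC] at hbaseJ
  rw [eGp] at h31J
  rw [eC] at h32J
  rw [eGp, eGA] at h33J
  have h32J' : B9.Thm32Printed (d + 1) c35Y (fun j => geo9Y (f j)) (fun j => bg9YC 𝔸 G P (f j)) (CinvY P f G parA) := h32J
  have h33J' : B9.Thm33Printed c35Y (fun j => geo9Y (f j)) (fun j => bg9YC 𝔸 G P (f j))
      (fun j => kernelFamilyS (f j).toKIdx (bg9YC 𝔸 G P (f j)) (fun U => U) (GpY (f j).toKIdx (parA j)) (parH j))
      (fun j => kernelFamilyB (f j).toKIdx (bg9YC 𝔸 G P (f j)) (fun U => U)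
        (OA j) (parBY (f j).toKIdx)) := h33J
  have hBU := hB h32J' h33J'
  -- (3) over the coded carrier
  have hbaseU := baseU1Printed_codedUPar P G f C38 parA parH
    OA (fun j => parBY (f j).toKIdx)
    C37 (CinvY P f G parA) (d + 1) hbaseJ
  have h31U := thm31Printed_codedUPar P G f C38 parA parH c35Y C37 h31J
  have h32U := thm32Printed_codedU P f c35Y G C38 (C37 := C37)
    (Cinv := CinvY P f G parA) (d + 1) h32J
  have h33U := thm33Printed_codedUPar P G f C38 parA parH
    OA (fun j => parBY (f j).toKIdx) c35Y
    C37 h33J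
  have honeU : ∀ (j : J) (α₀ : ℝ), 0 < α₀ → ((carriersYUParHX P G f b C37 C38 parA parH OA ops).bg9 j).Reg335 c35Y α₀ ((carriersYUParHX P G f b C37 C38 parA parH OA ops).bg9 j).one :=
    fun j α₀ hα => hone j α₀ hα
  have h35 := B9.cor35_of_sectB_base (d + 1) c35Y (carriersYUParHX P G f b C37 C38 parA parH OA ops).geo9 (carriersYUParHX P G f b C37 C38 parA parH OA ops).bg9
    (carriersYUParHX P G f b C37 C38 parA parH OA ops).Gp (carriersYUParHX P G f b C37 C38 parA parH OA ops).GA (carriersYUParHX P G f b C37 C38 parA parH OA ops).Cinv (carriersYUParHX P G f b C37 C38 parA parH OA ops).IsAnalyticExt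
    honeU hbaseU hBU
  have hg : B9.GaugeReduction335 (d + 1) c35Y (carriersYUParHX P G f b C37 C38 parA parH OA ops).geo9 (carriersYUParHX P G f b C37 C38 parA parH OA ops).bg9 (carriersYUParHX P G f b C37 C38 parA parH OA ops).InCube
      (carriersYUParHX P G f b C37 C38 parA parH OA ops).Gp (carriersYUParHX P G f b C37 C38 parA parH OA ops).GA (carriersYUParHX P G f b C37 C38 parA parH OA ops).Cinv :=
    fun j hj => absurd hj (not_inCubeY (f j))
  have h36 := B9.cor36_of_cor35 (d + 1) c35Y c35Y_pos _ _ _ _ _ _ h35 hg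
  have h34 := B9.thm34_of_sectB (d + 1) c35Y (carriersYUParHX P G f b C37 C38 parA parH OA ops).geo9 (carriersYUParHX P G f b C37 C38 parA parH OA ops).bg9
    (carriersYUParHX P G f b C37 C38 parA parH OA ops).Gp (carriersYUParHX P G f b C37 C38 parA parH OA ops).GA (carriersYUParHX P G f b C37 C38 parA parH OA ops).Cinv (carriersYUParHX P G f b C37 C38 parA parH OA ops).IsAnalyticExt
    hBU h32U h33U
  exact ⟨⟨h35, h36, h31U, h32U, h33U, h34,
      thm37Printed_coded c35Y _ _ (fun j => codingYx P G (f j) (C37 j) (C38 j)) _ (thm37Printed_reindex f c35Y geo9Y _ _ t37),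
      cor38Printed_coded c35Y _ _ (fun j => codingYx P G (f j) (C37 j) (C38 j)) _ (cor38Printed_reindex f c35Y geo9Y _ _ c38),
      thm39Printed_coded (d + 1) c35Y _ _ (fun j => codingYx P G (f j) (C37 j) (C38 j)) _ (thm39Printed_reindex f (d + 1) c35Y geo9Y _ _ t39),
      thm310Printed_coded c35Y _ _ (fun j => codingYx P G (f j) (C37 j) (C38 j)) _ (thm310Printed_reindex f c35Y geo9Y _ _ t310),
      thm311Printed_coded c35Y _ _ (fun j => codingYx P G (f j) (C37 j) (C38 j)) _ (thm311Printed_reindex f c35Y geo9Y _ _ t311),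
      thm312Printed_coded (d + 1) c35Y _ _ (fun j => codingYx P G (f j) (C37 j) (C38 j)) _ _ _ _ _ _ _ (thm312Printed_reindex f (d + 1) c35Y geo9Y _ _ _ _ _ _ _ _ t312),
      thm313Printed_coded c35Y _ _ (fun j => codingYx P G (f j) (C37 j) (C38 j)) _ _ _ (thm313Printed_reindex f c35Y geo9Y _ _ _ _ t313),
      thm314Printed_coded c35Y _ _ (fun j => codingYx P G (f j) (C37 j) (C38 j)) _ _ (thm314Printed_reindex f c35Y geo9Y _ _ _ t314),
      thm315FullPrinted_coded c35Y _ _ (fun j => codingYx P G (f j) (C37 j) (C38 j)) _ _ _ _ _ (thm315FullPrinted_reindex f c35Y geo9Y _ _ _ _ _ _ t315)⟩,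
    stmt349Printed_coded (d + 1) c35Y _ _ (fun j => codingYx P G (f j) (C37 j) (C38 j)) _ (stmt349Printed_reindex f (d + 1) c35Y geo9Y _ _ s349),
    stmt3132Printed_coded (d + 1) c35Y _ _ (fun j => codingYx P G (f j) (C37 j) (C38 j)) _ _ (stmt3132Printed_reindex f (d + 1) c35Y geo9Y _ _ _ s3132),
    thm314LocalPrinted_coded c35Y _ _ (fun j => codingYx P G (f j) (C37 j) (C38 j)) _ _ _ (thm314LocalPrinted_reindex f c35Y geo9Y _ _ _ _ t314loc)⟩


end Knit

end Literature.MathematicalPhysics.QuantumFieldTheory.Balaban1983to89.B9LeafXCodedKnitUParHX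

end
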